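import Summits.CriticalPhenomena.PercolationContinuityZ3.Theorems.FK.InfiniteVolumeGibbs
import Summits.CriticalPhenomena.PercolationContinuityZ3.Theorems.FK.InfiniteVolumeErgodic
import Summits.CriticalPhenomena.PercolationContinuityZ3.Theorems.FK.InfiniteVolumeFKG
import Literature.Probability.LatticeModels.RandomClusterInfiniteVolume
import HarnessLib

/-!
# FK-continuity transplant, FO-06: bridge between the cell's infinite-volume vocabulary and its Literature mirror

Cell `fk-continuity` (bschramm), seat A; support file (`--supports stmt-CriticalPhenomena-4575`); builds on p205010
(kernel theorem, internal audit signed; external expert review pending).  The Literature file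
`Literature.Probability.LatticeModels.RandomClusterInfiniteVolume` (`RCBoundary`, `toLattice`, `rcLaw`, `rcBoxLaw`,
`IsRandomClusterLimit`, `IsFKGibbs`) and the cell's `InfiniteVolumeDefs` / `InfiniteVolumeGibbs` (`boxBC`, `liftEdges`,
`rcBoxLaw`, `IsBoxLimit`, `FKGibbs`) formalise the same objects of Grimmett 2006, §4.2–4.3 twice (`Bool`- vs.
`RCBoundary`-indexed).  This file records that they agree — definitionally for the box laws, as an `iff` for the limit
predicate — and that the Literature hypothesis structure `IsFKGibbs` (which also carries translation invariance, FKG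
and ergodicity) implies the cell's `FKGibbs`; so nothing in the tree is a dangling duplicate.  Pure proofs.

## References

* G. Grimmett, *The Random-Cluster Model*, Springer 2006: §4.2 (4.11)–(4.12), Thm. (4.19)(a), Lemma (4.13),
  Lemma (4.14)(b). [Grimmett2006]
-/

noncomputable section

open MeasureTheory Set Filter
open scoped Topology ENNReal

namespace Summit.CriticalPhenomena.PercolationContinuityZ3.Theorems.FK

open Literature.Probability.Percolation Literature.Probability.LatticeModels

variable {d : ℕ}

/-- `liftEdges` (cell) is `toLattice` (Literature). [cite: Grimmett2006, §4.2 (configurations on E_Λ)] -/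
theorem liftEdges_eq_toLattice (Λ : Finset (Site d)) : liftEdges Λ = toLattice Λ := rfl

/-- The wired sets agree. [cite: Grimmett2006, §4.2 (4.11)–(4.12)] -/
theorem boxBC_eq_wiredSet (b : Bool) (n : ℕ) : boxBC d b n = (bif b then RCBoundary.wired else RCBoundary.free).wiredSet (box d n) := by
  cases b <;> rfl

/-- **The box laws agree definitionally**: the cell's `rcBoxLaw d b p q n` is the Literature mirror's
`rcBoxLaw d (bif b then RCBoundary.wired else RCBoundary.free) p q n`. [cite: Grimmett2006, §4.2 (4.11)–(4.12)] -/
theorem rcBoxLaw_eq_literature (b : Bool) (p q : ℝ) (n : ℕ) :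
    rcBoxLaw d b p q n = Literature.Probability.LatticeModels.rcBoxLaw d (bif b then RCBoundary.wired else RCBoundary.free) p q n := by
  cases b <;> rfl

/-- **The limit predicates agree**: `IsBoxLimit d b p q P ↔ IsRandomClusterLimit d (bif b then RCBoundary.wired else RCBoundary.free) p q P`.
[cite: Grimmett2006, Thm. (4.19)(a)] -/
theorem isBoxLimit_iff_isRandomClusterLimit {b : Bool} {p q : ℝ} {P : Measure (BondConfig (Site d))} :
    IsBoxLimit d b p q P ↔ IsRandomClusterLimit d (bif b then RCBoundary.wired else RCBoundary.free) p q P := by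
  constructor
  · intro h
    refine ⟨h.isProbabilityMeasure, fun A hA => ?_⟩
    simpa only [← rcBoxLaw_eq_literature] using h.tendsto_of_isLocalEvent A hA
  · intro h
    refine ⟨h.isProbabilityMeasure, fun A hA => ?_⟩
    simpa only [rcBoxLaw_eq_literature] using h.tendsto_isLocalEvent A hA

/-- The Literature region law of a measurable event is the cell's `regionFreeReal`. [cite: Grimmett2006, §4.2 (4.11)–(4.12), ξ = 0] -/
theorem rcLaw_empty_real_eq_regionFreeReal (p q : ℝ) (Λ : Finset (Site d)) {A : Set (BondConfig (Site d))}
    (hA : MeasurableSet A) :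
    (rcLaw d p q Λ ∅).real A = regionFreeReal d p q Λ A := by
  rw [rcLaw_real_apply p q Λ ∅ hA, regionFreeReal, liftEdges_eq_toLattice]

/-- The Literature wired region law of a measurable event is the cell's `regionWiredReal`. [cite: Grimmett2006, §4.2 (4.11)–(4.12), ξ = 1] -/
theorem rcLaw_wired_real_eq_regionWiredReal (p q : ℝ) (Λ : Finset (Site d)) {A : Set (BondConfig (Site d))}
    (hA : MeasurableSet A) :
    (rcLaw d p q Λ (wiredBoundary (zdGraph d) Λ)).real A = regionWiredReal d p q Λ A := by
  rw [rcLaw_real_apply p q Λ _ hA, regionWiredReal, liftEdges_eq_toLattice]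

/-- **The Literature hypothesis structure implies the cell's interface**: `IsFKGibbs d p q P → FKGibbs d p q P`
(the sandwich fields coincide on the — automatically measurable — local events they quantify over; `IsFKGibbs`
additionally records translation invariance, FKG and ergodicity). [cite: Grimmett2006, Lemma (4.13) and Lemma (4.14)(b)] -/
theorem fkGibbs_of_isFKGibbs {p q : ℝ} {P : Measure (BondConfig (Site d))} (h : IsFKGibbs d p q P) :
    FKGibbs d p q P where
  isProbabilityMeasure := h.isProbabilityMeasure
  ae_subset_edgeSet := h.ae_subset_edgeSet
  free_mul_le Λ A _ T hA hAΛ hT hH := by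
    rw [← rcLaw_empty_real_eq_regionFreeReal p q Λ (measurableSet_of_isLocalEvent_holds ⟨_, hAΛ⟩)]
    exact h.free_mul_le Λ T hA hAΛ hT hH
  le_wired_mul Λ A _ T hA hAΛ hT hH := by
    rw [← rcLaw_wired_real_eq_regionWiredReal p q Λ (measurableSet_of_isLocalEvent_holds ⟨_, hAΛ⟩)]
    exact h.le_wired_mul Λ T hA hAΛ hT hH

/-! ### Capstone: the box limits satisfy the Literature hypothesis structure `IsFKGibbs`

The discharge theorem announced in the module docstring of `Literature.Probability.LatticeModels.RandomClusterInfiniteVolume`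
("that `φ^b_{p,q}` satisfy `IsFKGibbs` is a theorem of the companion files"): all seven fields, assembled from the cell's
construction half (`InfiniteVolumeMeasures`: probability, lattice support; `InfiniteVolumeInvariance`: Thm. (4.19)(b);
`InfiniteVolumeFKG`: Thm. (4.17)(b)) and interface half (`InfiniteVolumeDLR`: Lemma (4.13) with Lemma (4.14)(b) in the
limit; `InfiniteVolumeErgodic`: Cor. (4.23)).  With it a consumer in EITHER vocabulary — `(h : IsFKGibbs d p q P)`,
`(h : IsRandomClusterLimit d b p q P)` (`b : RCBoundary`), `(h : IsBoxLimit d b p q P)` (`b : Bool`), or the canonical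
`rcLimit d b p q` — is unconditional for `p ∈ [0,1]`, `q ≥ 1`, in every dimension `d` (no `0 < d` hypothesis). -/

/-- **Capstone — every box limit `φ^b_{p,q}` satisfies the Literature hypothesis structure `IsFKGibbs`** (all seven
fields), for `p ∈ [0,1]`, `q ≥ 1` and either boundary condition `b`: probability and lattice support, translation
invariance (Thm. (4.19)(b)), positive association on increasing local events (Thm. (4.17)(b)), the free/wired sandwich
given local information outside a finite region (Lemma (4.13) with Lemma (4.14)(b), passed to the limit (4.20)), and
ergodicity under every non-zero translation (Cor. (4.23)).
[cite: Grimmett2006, Thm. (4.17)(b), Thm. (4.19)(a)(b), Lemma (4.13), Lemma (4.14)(b), Cor. (4.23)] -/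
theorem IsBoxLimit.isFKGibbs {b : Bool} {p q : ℝ} {P : Measure (BondConfig (Site d))} (hP : IsBoxLimit d b p q P)
    (hp : p ∈ Set.Icc (0 : ℝ) 1) (hq : 1 ≤ q) : IsFKGibbs d p q P where
  isProbabilityMeasure := hP.isProbabilityMeasure
  ae_subset_edgeSet := hP.ae_subset_edgeSet hp (one_pos.trans_le hq)
  measurePreserving_shift v := hP.measurePreserving_relabel_shift hp hq v
  fkg _ _ hA hB hAu hBu :=
    hP.real_mul_le_inter hp hq hAu hBu (measurableSet_of_isLocalEvent_holds hA) (measurableSet_of_isLocalEvent_holds hB)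
  free_mul_le Λ _ _ T hA hAΛ hT hH := by
    rw [rcLaw_empty_real_eq_regionFreeReal p q Λ (measurableSet_of_isLocalEvent_holds ⟨_, hAΛ⟩)]
    exact hP.regionFreeReal_mul_le hp hq Λ T hA hAΛ hT hH
  le_wired_mul Λ _ _ T hA hAΛ hT hH := by
    rw [rcLaw_wired_real_eq_regionWiredReal p q Λ (measurableSet_of_isLocalEvent_holds ⟨_, hAΛ⟩)]
    exact hP.le_regionWiredReal_mul hp hq Λ T hA hAΛ hT hH
  ergodic_shift _ hv := hP.ergodic_shift' hp hq hv

/-- **The cell's canonical limit `rcLimit d b p q = φ^b_{p,q}` satisfies `IsFKGibbs`** (`p ∈ [0,1]`, `q ≥ 1`, `b ∈ {free,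
wired}`, every `d`). [cite: Grimmett2006, Thm. (4.17)(b), Thm. (4.19)(a)(b), Lemma (4.13), Lemma (4.14)(b), Cor. (4.23)] -/
theorem isFKGibbs_rcLimit (b : Bool) {p q : ℝ} (hp : p ∈ Set.Icc (0 : ℝ) 1) (hq : 1 ≤ q) :
    IsFKGibbs d p q (rcLimit d b p q) :=
  (isBoxLimit_rcLimit b hp hq).isFKGibbs hp hq

/-- **Literature vocabulary**: every limit random-cluster measure `φ^b_{p,q}` in the sense of `IsRandomClusterLimit d b p q P`
(`b : RCBoundary`, `p ∈ [0,1]`, `q ≥ 1`) satisfies `IsFKGibbs d p q P` — the hypothesis structure of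
`RandomClusterInfiniteVolume.lean` is discharged for both of its limit measures, in every dimension.
[cite: Grimmett2006, Thm. (4.17)(b), Thm. (4.19)(a)(b), Lemma (4.13), Lemma (4.14)(b), Cor. (4.23)] -/
theorem isFKGibbs_of_isRandomClusterLimit {b : RCBoundary} {p q : ℝ} {P : Measure (BondConfig (Site d))}
    (h : IsRandomClusterLimit d b p q P) (hp : p ∈ Set.Icc (0 : ℝ) 1) (hq : 1 ≤ q) : IsFKGibbs d p q P := by
  cases b
  · exact ((isBoxLimit_iff_isRandomClusterLimit (b := false)).2 h).isFKGibbs hp hq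
  · exact ((isBoxLimit_iff_isRandomClusterLimit (b := true)).2 h).isFKGibbs hp hq

/-- … and hence the cell's sandwich interface: `IsRandomClusterLimit d b p q P → FKGibbs d p q P` (`p ∈ [0,1]`, `q ≥ 1`), so
every `(hG : FKGibbs d p q P)` theorem under `Theorems/FK/` applies to a Literature limit in one line.
[cite: Grimmett2006, Lemma (4.13), Lemma (4.14)(b), Thm. (4.19)(a)] -/
theorem fkGibbs_of_isRandomClusterLimit {b : RCBoundary} {p q : ℝ} {P : Measure (BondConfig (Site d))}
    (h : IsRandomClusterLimit d b p q P) (hp : p ∈ Set.Icc (0 : ℝ) 1) (hq : 1 ≤ q) : FKGibbs d p q P :=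
  fkGibbs_of_isFKGibbs (isFKGibbs_of_isRandomClusterLimit h hp hq)

/-- **The cell's canonical limit is the Literature limit**: `rcLimit d b p q` is `IsRandomClusterLimit d b♯ p q` with
`b♯ = wired` for `b = true` and `b♯ = free` for `b = false` — existence of `φ^b_{p,q}` in the Literature vocabulary for
`p ∈ [0,1]`, `q ≥ 1`, in every dimension `d`. [cite: Grimmett2006, Thm. (4.19)(a)] -/
theorem isRandomClusterLimit_rcLimit (b : Bool) {p q : ℝ} (hp : p ∈ Set.Icc (0 : ℝ) 1) (hq : 1 ≤ q) :
    IsRandomClusterLimit d (bif b then RCBoundary.wired else RCBoundary.free) p q (rcLimit d b p q) :=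
  isBoxLimit_iff_isRandomClusterLimit.1 (isBoxLimit_rcLimit b hp hq)

/-- **Identification, free**: a measure which is the free Literature limit `φ⁰_{p,q}` IS the cell's `rcLimit d false p q`
(uniqueness of the local limit), so every `rcLimit` theorem under `Theorems/FK/` transports to it by `rw`.
[cite: Grimmett2006, Thm. (4.19)(a)] -/
theorem eq_rcLimit_of_isRandomClusterLimit_free {p q : ℝ} {P : Measure (BondConfig (Site d))}
    (h : IsRandomClusterLimit d RCBoundary.free p q P) : P = rcLimit d false p q :=
  ((isBoxLimit_iff_isRandomClusterLimit (b := false)).2 h).eq_rcLimit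

/-- **Identification, wired**: a measure which is the wired Literature limit `φ¹_{p,q}` IS the cell's `rcLimit d true p q`.
[cite: Grimmett2006, Thm. (4.19)(a)] -/
theorem eq_rcLimit_of_isRandomClusterLimit_wired {p q : ℝ} {P : Measure (BondConfig (Site d))}
    (h : IsRandomClusterLimit d RCBoundary.wired p q P) : P = rcLimit d true p q :=
  ((isBoxLimit_iff_isRandomClusterLimit (b := true)).2 h).eq_rcLimit

end Summit.CriticalPhenomena.PercolationContinuityZ3.Theorems.FK

end
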